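import Summits.Ventures.PercRepro.MSRMStarMixedResidue
import Summits.Ventures.PercRepro.MSExcessIdentities

/-!
# The pair lemma, part 1: absorption of minimal members and the three types of a direction

Dossier proofs/MINE1-theoremS.md, Addendum 63. Let `F` be an excess-one family and `z` a
non-tightening direction with a nonempty partner family. Theorem (NT) (2a) puts every minimal member
`m` of `F₀ = part0 r F` avoiding `z` inside the addable set `R_z = Rstar (partner z F)`
(`subset_Rstar_of_isMinIn`), and (2b) lifts every face `A ∋ z` to `A ∪ R_z`; hence **(ABS)**:
`A ∪ m` is a face (`union_isMinIn_mem_proj`). In a residue instance every direction `z ≠ r` is of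
one of three types (`type_trichotomy`): (n) non-tightening with a nonempty partner family, (s) `{z}`
a member avoiding `r`, or (c) `S' ∖ z` an `r`-lifted face — the last two by (SING-t)
(`sing_t_of_residue`) at a tightening `z`, and (s) also when the partner family of a non-tightening
`z` is empty (`{r}` would be a partner member). In the mixed class (s) and (c) exclude each other
(`not_singleton_mem_part0_of_compl_mem_partr`): `S' ∖ z` and `{z}` would be a complementary pair.
-/

namespace PercRepro.MSTight

open Finset
open scoped FinsetFamily

variable {α : Type*} [DecidableEq α] [Fintype α]

section Absorption

variable {F : Finset (Finset α)} {r : α}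

omit [Fintype α] in
/-- The non-tightening count at any non-tightening direction of an excess-one family. -/
theorem nonTightening_count (hF : (F \\ F).card = F.card + 1) {z : α}
    (hnt : ¬ Tight (proj z F)) :
    (diffsX z F ∩ diffsY z F).card = (partner z F).card := by
  have h1 := card_diffs_eq_card_diffs_proj_add z F
  have h2 := card_eq_card_proj_add_card_partner z F
  have h3 := Finset.card_le_card_diffs (proj z F)
  have h4 := card_partner_le_card_edges_diffs z F
  unfold Tight at hnt
  omega

/-- A minimal member of `F₀` avoiding a non-tightening `z` lies inside `R_z` (Theorem (NT) (2a)). -/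
theorem subset_Rstar_of_isMinIn {z : α}
    (hε : (diffsX z F ∩ diffsY z F).card = (partner z F).card) (hK : (partner z F).Nonempty)
    {m : Finset α} (hm : IsMinIn (part0 r F) m) (hzm : z ∉ m) : m ⊆ Rstar (partner z F) := by
  have hm0 : m ∈ part0 z F := mem_part0.2 ⟨(mem_part0.1 hm.1).1, hzm⟩
  have hmem := inter_Rstar_mem_partner hε hK hm0
  have h1 : m ∩ Rstar (partner z F) ∈ part0 r F :=
    mem_part0.2 ⟨mem_of_mem_partner hmem, fun hr => (mem_part0.1 hm.1).2 (mem_inter.1 hr).1⟩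
  have h2 : m ∩ Rstar (partner z F) = m := hm.2 _ h1 inter_subset_left
  intro a ha
  have : a ∈ m ∩ Rstar (partner z F) := by rw [h2]; exact ha
  exact (mem_inter.1 this).2

/-- **(ABS)**: a face containing a non-tightening direction `z` (with a nonempty partner family)
absorbs every minimal member of `F₀` avoiding `z` (Theorem (NT) (2b) after (2a)). -/
theorem union_isMinIn_mem_proj (hP : Tight (proj r F)) (hr : ({r} : Finset α) ∈ F)
    (hsing : ∀ a, a ≠ r → ({a} : Finset α) ∈ proj r F) {z : α}
    (hε : (diffsX z F ∩ diffsY z F).card = (partner z F).card) (hK : (partner z F).Nonempty)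
    {A : Finset α} (hA : A ∈ proj r F) (hzA : z ∈ A) {m : Finset α}
    (hm : IsMinIn (part0 r F) m) (hzm : z ∉ m) : A ∪ m ∈ proj r F := by
  have hmR := subset_Rstar_of_isMinIn hε hK hm hzm
  obtain ⟨B, hB, rfl⟩ := mem_proj.1 hA
  have hzB : z ∈ B := mem_of_mem_erase hzA
  have hU := RMStar.union_Rstar_mem hB hzB hε hK
  have h1 : (B ∪ Rstar (partner z F)).erase r ∈ proj r F := mem_proj.2 ⟨_, hU, rfl⟩
  refine mem_proj_of_subset hP hr hsing h1 ?_
  intro a ha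
  rcases mem_union.1 ha with ha | ha
  · exact mem_erase.2 ⟨(mem_erase.1 ha).1, mem_union_left _ (mem_erase.1 ha).2⟩
  · exact mem_erase.2 ⟨fun e => (mem_part0.1 hm.1).2 (e ▸ ha), mem_union_right _ (hmR ha)⟩

omit [Fintype α] in
/-- A singleton member avoiding `r` is a minimal member (`∅` is not a member). -/
theorem isMinIn_singleton (hE : (∅ : Finset α) ∉ F) {a : α} (ha : ({a} : Finset α) ∈ part0 r F) :
    IsMinIn (part0 r F) {a} := by
  refine ⟨ha, fun y hy hya => ?_⟩
  rcases Finset.subset_singleton_iff.1 hya with rfl | rfl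
  · exact absurd (mem_part0.1 hy).1 hE
  · rfl

end Absorption

section Types

variable {F : Finset (Finset α)} {u : Finset α} {r : α}

/-- At a tightening direction `z ≠ r` of a residue instance, `{z}` is a member avoiding `r` or
`S' ∖ z` is an `r`-lifted face ((SING-t), `sing_t_of_residue`). -/
theorem singleton_mem_part0_or_compl_mem_partr (h : Residue F u) {z : α}
    (hT : Tight (proj z F)) (hzr : z ≠ r) :
    ({z} : Finset α) ∈ part0 r F ∨ (univ.erase z).erase r ∈ partr r F := by
  rcases sing_t_of_residue h hT with h1 | h2
  · exact Or.inl (mem_part0.2 ⟨h1, fun e => hzr (mem_singleton.1 e).symm⟩)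
  · refine Or.inr (mem_partr.2 ⟨notMem_erase r _, ?_⟩)
    rw [insert_erase (mem_erase.2 ⟨hzr.symm, mem_univ r⟩)]
    exact h2

omit [Fintype α] in
/-- A direction `z ≠ r` with an empty partner family has `{z}` as a member avoiding `r`: otherwise
`{z}` is `r`-lifted and `{r}` is a `z`-partner member. -/
theorem singleton_mem_part0_of_partner_empty (hr : ({r} : Finset α) ∈ F)
    (hsing : ∀ a, a ≠ r → ({a} : Finset α) ∈ proj r F) {z : α} (hzr : z ≠ r)
    (hK : ¬ (partner z F).Nonempty) : ({z} : Finset α) ∈ part0 r F := by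
  rcases RMStar.part0_or_partr (hsing z hzr) with h0 | h1
  · exact h0
  · exfalso
    apply hK
    refine ⟨{r}, mem_partner_iff.2 ⟨hr, fun e => hzr (mem_singleton.1 e), ?_⟩⟩
    have := (mem_partr.1 h1).2
    rw [Finset.pair_comm]
    exact this

/-- **The three types** of a direction `z ≠ r` in a residue instance: (n) non-tightening with a
nonempty partner family, (s) `{z}` a member avoiding `r`, (c) `S' ∖ z` an `r`-lifted face. -/
theorem type_trichotomy (h : Residue F u) (hr : ({r} : Finset α) ∈ F)
    (hsing : ∀ a, a ≠ r → ({a} : Finset α) ∈ proj r F) {z : α} (hzr : z ≠ r) :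
    (¬ Tight (proj z F) ∧ (partner z F).Nonempty) ∨ ({z} : Finset α) ∈ part0 r F ∨
      (univ.erase z).erase r ∈ partr r F := by
  by_cases hT : Tight (proj z F)
  · exact Or.inr (singleton_mem_part0_or_compl_mem_partr h hT hzr)
  · by_cases hK : (partner z F).Nonempty
    · exact Or.inl ⟨hT, hK⟩
    · exact Or.inr (Or.inl (singleton_mem_part0_of_partner_empty hr hsing hzr hK))

/-- `(S' ∖ z) ⊔ {z} = S'` for `z ≠ r`. -/
theorem compl_union_singleton_eq {z : α} (hzr : z ≠ r) :
    (univ.erase z).erase r ∪ {z} = univ.erase r := by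
  ext a
  simp only [mem_union, mem_erase, mem_univ, and_true, mem_singleton]
  constructor
  · rintro (⟨h1, -⟩ | rfl)
    · exact h1
    · exact hzr
  · intro h1
    by_cases haz : a = z
    · exact Or.inr haz
    · exact Or.inl ⟨h1, haz⟩

/-- In the mixed class, types (s) and (c) exclude each other: `S' ∖ z` and `{z}` would be a
complementary pair. -/
theorem not_singleton_mem_part0_of_compl_mem_partr {u₀ : Finset α} (hM : MixedII r F u₀) {z : α}
    (hzr : z ≠ r) (hc : (univ.erase z).erase r ∈ partr r F) :
    ({z} : Finset α) ∉ part0 r F := fun hs =>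
  hM.valid _ hc _ hs (by
      rw [Finset.disjoint_singleton_right]
      exact fun hz => (mem_erase.1 (mem_erase.1 hz).2).1 rfl)
    (compl_union_singleton_eq hzr)

end Types

end PercRepro.MSTight
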